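/-
Copyright (c) 2026 the pub-hodgecm-mathlib formalisation cell (harness21).  Prover seat hodgecm-mathlib-LH4-p10 (g5), req620 Track A «(D-RAM) FOUR-FRAME» squad, helper lane
on h413 = stmt-HodgeConjecture-24833 (count-neutral).  STAGE-1b scoping brick (N-vol-wild) FILE 4c (dealer LH4-plan (g12) WORD #37∕#45; F0P3-p01 (g35) 09:38Z ask; heir
LEAD F0P3a-plan (g20) T19-24∕T19-30): THE LABELLED SHELL FIBRE VOLUME — the unipotent-fibre volume of `f_{T+}` at a wild ramified place.  2026-09-04.
-/
import Summits.HodgeConjecture.HodgeConjecture.Theorems.F0P3cDyRamUnipotentLabelLocus        -- ★ FILE 4b (this seat): label locus measurable, clean-fibre skew representative, Tonelli with translate sections; brings ★ DEFS №3, ★ p859078∕p859059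
import Summits.HodgeConjecture.HodgeConjecture.Theorems.F0P3cDyRamHeisenbergShellValueSet     -- ★ p859171 (LH4-p13 (g8), (L-lab-6)): `labelPlus_heis_iff_exists_norm_of_deep`, `not_labelPlus_heis_of_shallow`
import Literature.NumberTheory.Automorphic.HeisenbergWildSkewNormClassHalving                  -- ★ p859184 (this seat, FILE 4a): `measure_skewShell_isNorm_eq` (`μ⁻(A₊) = ((1−q⁻¹)∕2)μ⁻(B₀)`), `isOpen_skewShell_isNorm`, `map_skew_apply_eq_neg`
import Literature.NumberTheory.Automorphic.HeisenbergWildLevelFibreVolume                     -- ★ p859102 (this seat, FILE 3): `preimage_heisHomeomorph_setOf_mem_eq`, `isClosed_setOf_mem_and_levels`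
import Literature.NumberTheory.LocalFields.ValuedCompleteIsAdicComplete                        -- ★ `isAdicComplete_valuedInteger_of_completeSpace`
import HarnessLib

/-!
# Crux `H413`, line LH4 «(D-RAM) FOUR-FRAME» — THE LABELLED SHELL FIBRE VOLUME:
# `μ_N{n ∈ K₃ : NearTransvShell ϖ ℓ₀ m* (n_w − 1) ∧ LabelPlus σ_w ϖ d m* (n_w − 1)} = ½(1 − q⁻¹)·q^{−(⌊(m*+d)∕2⌋ − ⌊d∕2⌋)}·μ_N{n ∈ K₃}` (`d ≥ 2`, every Haar `μ_N`)

Cell `hodgecm-mathlib` (D-0151), FLOOR 0, crux item H413 = `stmt-HodgeConjecture-24833`, route of record `HCCMUnconditional`; squad F0∕P3c∕LH4 (req618∕req620); helper lane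
`--supports stmt-HodgeConjecture-24833 --as helper` (count-neutral).  THEOREMS ONLY (no `def`, no instance, no notation, no `sorry`).  STAGE-1b scoping (heir LEAD F0P3a-plan
(g20) T19-24∕T19-30; dealer WORD #37 (N-vol-wild) → LH4-p10 (g5), WORD #45: label READING (L-lab-6) = LH4-p13 (g8) ★ p859171, VOLUME = this seat).

WHAT.  At a WILD ramified non-split CM place `w ∣ v` (`IsRamifiedQuadraticDatum σ_w ϖ d t`, `2 ≤ d`; `ℓ₀ = d % 2`, `m* = ℓ₀ + 2d − 1` = ★ DEFS №3 `mstarOfRecord d`,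
`k_c = ⌊(m*+d)∕2⌋ = (ℓ₀ + 3d − 1)∕2`, `q = N𝔭_v`), for EVERY Haar measure `μ_N` of `N = unipotentU (c ⊗ 1) Φ₃`, the set of `n ∈ N ∩ K₃` whose `w`-matrix `X = n_w − 1`
(`n_w = ((n : U) : GL₃ R).val.map (evalRingHom w)` = ★ `wMatrix L w hw n`, `rfl`) lies on the near-transvection shell `NearTransvShell ϖ ℓ₀ m* X` AND carries the class-`+`
label `LabelPlus σ_w ϖ d m* X` (★ DEFS №3 — TOKEN FOR TOKEN the support condition of `pieceTransvPlus` after `dOfPlace = d`, ★ `dOfPlace_eq_of_isRamifiedQuadraticDatum`) has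
measure **`((1 − q⁻¹)∕2)·q^{−(k_c − ⌊d∕2⌋)}·μ_N{n ∈ K₃}`** — F0P3-p01 (g35)'s FIBRE-VOLUMES 775a2121 row `f_{T+}` (`½(1 − q⁻¹)q^{−(d−1+ℓ₀)}`; machine-checked d = 2..5)
for every `d ≥ 2`; and the shell itself has measure `(1 − q⁻¹)·q^{−(d − ⌊d∕2⌋)}·μ_N{n ∈ K₃}`, so Lean's `pieceTransvMinus = shell ∧ ¬LabelPlus` has the DIFFERENCE (NOT the
plus volume unless `d = 2`: the unclean band `d ≤ v_w(x) < k_c` is label-free, ★ `not_labelPlus_heis_of_shallow`).  Consumer: row (3) of `stub_rows_transvPlus ∕ transvMinus` via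
LH4-p08 (g7)'s ★ p858969 `F0P3cDyRamPieceLeviRow` (the G-side Levi clause is `ρ · (anchor)`, `ρ = ∫_N f ∕ μ_N(N ∩ K₃)`).

HOW (all ★).  In the chart `n = u(x, z)` (★ p859059) the set is `T₊ = {(x, y) : [K₃ ∧ shell] ∧ LabelPlus(X(x_w, z_w))}`; `T₊` is MEASURABLE (★ FILE 3 closed level sets + ★
FILE 4b: the label locus of the chart is open with open complement).  Its `x`-sections: for CLEAN `x` (`|x_w| ≤ |ϖ|^{k_c}`) ★ FILE 4b gives a skew `s₁` with `z_w ≡ (y − s₁)_w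
(mod ϖ^{m*})`, the shell forces `|z_w| = |ϖ|^{ℓ₀}` (as `k_c ≥ ℓ₀ + 1`), and ★ p859171 `labelPlus_heis_iff_exists_norm_of_deep` reads the label as «`(y − s₁)_w ∕ t₊` is a
norm»: the section is the TRANSLATE `s₁ + A₊` of the skew norm-class shell `A₊` of ★ FILE 4a; for UNCLEAN `x` the section is EMPTY (★ `not_labelPlus_heis_of_shallow`, trace
identity ★ `heisZ_apply_add_map`).  Tonelli with translate sections (★ FILE 4b) and `μ_N = κ·chart_*(μ_R ⊗ μ⁻)` (★ FILE 2) give `μ_N(S₊) = κ·μ_R{|x_w| ≤ |ϖ|^{k_c}}·μ⁻(A₊)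
= κ·q^{−k_c}μ_R(𝒪)·((1 − q⁻¹)∕2)μ⁻(B₀)` (★ FILE 2 ball scaling, ★ FILE 4a halving), against `μ_N{K₃} = κ·q^{−⌊d∕2⌋}μ_R(𝒪)·μ⁻(B₀)` (★ FILE 2∕3).
HONEST LABEL: count-neutral scoping, pays no row by itself; HC_CM is proved only modulo the 7 printed citations (2 remaining named inputs: hLiu418 = `stmt-HodgeConjecture-24832`,
h413 = `stmt-HodgeConjecture-24833`) until rung 0 closes.

## References
* [Rogawski1990] J. D. Rogawski, *Automorphic Representations of Unitary Groups in Three Variables*, Ann. of Math. Stud. 123 (1990), §4.9 Prop. 4.9.1 (b) p. 55; §1.10 p. 9.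
* [Serre1979] J.-P. Serre, *Local Fields*, GTM 67 (1979), Ch. III §3 Prop. 7 (trace images), Ch. V §3 Cor. 3, Ch. XV §2 (norm classes, conductor).
* [Kottwitz1986BaseChangeUnits] R. E. Kottwitz, *Base change for unit elements of Hecke algebras*, Compositio Math. 60 (1986), §1 pp. 240–241 (level pieces, fibre volumes).
* [LanglandsShelstad1987] R. P. Langlands, D. Shelstad, *On the definition of transfer factors*, Math. Ann. 278 (1987), §3 (the two unipotent classes).
-/

set_option autoImplicit false

noncomputable section

open IsDedekindDomain NumberField Matrix MeasureTheory Measure Topology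
open scoped NumberField MatrixGroups Matrix NNReal ENNReal WithZero Pointwise Valued

namespace Summit.HodgeConjecture.HodgeConjecture.Cruxes.H413.F0P3cDyRamTransvPlusUnipotentVolume

open Literature.NumberTheory.Automorphic Literature.NumberTheory.Automorphic.UnitaryGroup Literature.NumberTheory.Automorphic.IntegralReduction
open Literature.NumberTheory.Automorphic.UnitaryLatticeTree Literature.NumberTheory.Automorphic.HermitianLattice
open Literature.NumberTheory.GaloisRepresentations Literature.NumberTheory.LocalFields
open Summit.HodgeConjecture.HodgeConjecture.Cruxes.H413.F0P3cDyRamFourFramePieces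
open Summit.HodgeConjecture.HodgeConjecture.Cruxes.H413.F0P3cDyRamUnipotentLabelLocus
open Summit.HodgeConjecture.HodgeConjecture.Cruxes.H413.F0P3cDyRamHeisenbergShellValueSet (labelPlus_heis_iff_exists_norm_of_deep not_labelPlus_heis_of_shallow)

variable (L : Type) [Field L] [NumberField L] [IsCMField L] (v : HeightOneSpectrum (𝓞 ↥(maximalRealSubfield L)))
  (w : PlacesOver L v) (hw : IsCMField.complexConj L • w.1 = w.1)

/-! ## §1 `ℝ≥0∞` bookkeeping -/

/-- `κ·((q^k)⁻¹•A·(r•B)) = (r·(q^{k − k₀})⁻¹) • (κ·((q^{k₀})⁻¹•A·B))` for `k₀ ≤ k`. [cite: Kottwitz1986BaseChangeUnits, §1 pp. 240–241] -/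
theorem ENNReal.mul_inv_pow_smul_mul_smul (q : ℝ≥0) (κ r : ℝ≥0) (A B : ℝ≥0∞) {k₀ k : ℕ} (hk : k₀ ≤ k) :
    (κ : ℝ≥0∞) * ((((q ^ k)⁻¹ : ℝ≥0)) • A * (r • B)) = ((r * (q ^ (k - k₀))⁻¹ : ℝ≥0)) • ((κ : ℝ≥0∞) * ((((q ^ k₀)⁻¹ : ℝ≥0)) • A * B)) := by
  obtain ⟨e, rfl⟩ := Nat.exists_eq_add_of_le hk
  simp only [ENNReal.smul_def, smul_eq_mul, Nat.add_sub_cancel_left, pow_add, mul_inv, ENNReal.coe_mul]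
  ring

/-! ## §2 The sections of the labelled shell set in the chart -/

include hw in
/-- **CLEAN SECTION = TRANSLATE OF THE NORM-CLASS SHELL.**  `d ≥ 2`, `|x_w| ≤ |ϖ|^{k_c}` (`k_c = (d%2 + 3d − 1)∕2`), `s₁` the skew representative of ★ FILE 4b
(`z_w ≡ (y − s₁)_w`): `y ∈ R⁻` lies in the chart section `{y : u(x, z) ∈ K₃ ∧ shell ∧ LabelPlus}` iff `−s₁ + y ∈ A₊ = {s : |s_w| = |ϖ|^{ℓ₀} ∧ s_w∕t₊ ∈ N(L_w^×)}`.
[cite: Rogawski1990, §4.9 Prop. 4.9.1 (b) p. 55] [cite: Serre1979, Ch. V §3 Cor. 3] [cite: LanglandsShelstad1987, §3] -/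
theorem mem_section_labelled_iff_of_clean [Invertible (2 : LocalRing L v)] {ϖ : w.1.adicCompletion L} {d t : ℕ}
    (hD : UnitaryThreeFourFrame.IsRamifiedQuadraticDatum (galAdicCompletionMap (L := L) (IsCMField.complexConj L) hw) ϖ d t) (h2d : 2 ≤ d)
    {x : LocalRing L v} (hx : Valued.v (x w) ≤ WithZero.exp (-(((d % 2 + 3 * d - 1) / 2 : ℕ) : ℤ)))
    {s₁ : HeisRing.skewPart (conjLocal L (IsCMField.complexConj L) v)}
    (hs₁ : ∀ y : HeisRing.skewPart (conjLocal L (IsCMField.complexConj L) v),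
      Valued.v ((ϖ ^ (d % 2 + 2 * d - 1))⁻¹ * ((HeisRing.heisZ (conjLocal L (IsCMField.complexConj L) v) x (y : LocalRing L v)) w -
        (((y : LocalRing L v) - (s₁ : LocalRing L v)) w))) ≤ 1)
    (y : HeisRing.skewPart (conjLocal L (IsCMField.complexConj L) v)) :
    ((Valued.v (x w) ≤ 1 ∧ Valued.v ((HeisRing.heisZ (conjLocal L (IsCMField.complexConj L) v) x (y : LocalRing L v)) w) ≤ 1) ∧
      ((Valued.v (x w) ≤ WithZero.exp (-((d % 2 : ℕ) : ℤ)) ∧ Valued.v ((HeisRing.heisZ (conjLocal L (IsCMField.complexConj L) v) x (y : LocalRing L v)) w) ≤ WithZero.exp (-((d % 2 : ℕ) : ℤ))) ∧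
        ¬ (Valued.v (x w) ≤ WithZero.exp (-((d % 2 + 1 : ℕ) : ℤ)) ∧
            Valued.v ((HeisRing.heisZ (conjLocal L (IsCMField.complexConj L) v) x (y : LocalRing L v)) w) ≤ WithZero.exp (-((d % 2 + 1 : ℕ) : ℤ))) ∧
        Valued.v (x w) ≤ WithZero.exp (-(((d % 2 + 2 * d - 1 + 1) / 2 : ℕ) : ℤ))) ∧
      LabelPlus (galAdicCompletionMap (L := L) (IsCMField.complexConj L) hw) ϖ d (d % 2 + 2 * d - 1)
        !![0, x w, (HeisRing.heisZ (conjLocal L (IsCMField.complexConj L) v) x (y : LocalRing L v)) w;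
          0, 0, -(galAdicCompletionMap (L := L) (IsCMField.complexConj L) hw (x w)); 0, 0, (0 : w.1.adicCompletion L)]) ↔
    -s₁ + y ∈ {s : HeisRing.skewPart (conjLocal L (IsCMField.complexConj L) v) |
        Valued.v ((s : LocalRing L v) w) = WithZero.exp (-((d % 2 : ℕ) : ℤ)) ∧
          ∃ u : w.1.adicCompletion L, u * galAdicCompletionMap (L := L) (IsCMField.complexConj L) hw u =
            ((s : LocalRing L v) w) /
              ((ϖ - galAdicCompletionMap (L := L) (IsCMField.complexConj L) hw ϖ) * ((ϖ * galAdicCompletionMap (L := L) (IsCMField.complexConj L) hw ϖ) ^ ((d - d % 2) / 2))⁻¹)} := by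
  haveI := isAdicComplete_valuedInteger_of_completeSpace hD.2.2.1
  have hϖ : Valued.v ϖ = WithZero.exp (-1 : ℤ) := hD.2.2.1
  have htp0 := WildQuadraticDatum.refSkewScalar_ne_zero hD.2.1 hϖ hD.2.2.2.2.1
  -- the skew representative `s := (y − s₁)_w` of `z_w`
  have hzz := hs₁ y
  have hsw : ((-s₁ + y : HeisRing.skewPart (conjLocal L (IsCMField.complexConj L) v)) : LocalRing L v) w = ((y : LocalRing L v) - (s₁ : LocalRing L v)) w := by
    simp only [AddSubgroup.coe_add, AddSubgroup.coe_neg, Pi.add_apply, Pi.neg_apply, Pi.sub_apply]; ring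
  have hσs : galAdicCompletionMap (L := L) (IsCMField.complexConj L) hw (((y : LocalRing L v) - (s₁ : LocalRing L v)) w) = -(((y : LocalRing L v) - (s₁ : LocalRing L v)) w) := by
    rw [← hsw]; exact map_skew_apply_eq_neg L v w hw (-s₁ + y)
  -- `|z_w − s| ≤ |ϖ|^{m*} < |ϖ|^{ℓ₀}`, so `|z_w| = |ϖ|^{ℓ₀} ↔ |s| = |ϖ|^{ℓ₀}`
  have hsmall : Valued.v ((HeisRing.heisZ (conjLocal L (IsCMField.complexConj L) v) x (y : LocalRing L v)) w - (((y : LocalRing L v) - (s₁ : LocalRing L v)) w)) <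
      WithZero.exp (-((d % 2 : ℕ) : ℤ)) := by
    have h := (valued_inv_pow_mul_le_one_iff hϖ _ _).1 hzz
    exact h.trans_lt (WithZero.exp_lt_exp.2 (by push_cast; omega))
  have hshell_iff : Valued.v ((HeisRing.heisZ (conjLocal L (IsCMField.complexConj L) v) x (y : LocalRing L v)) w) = WithZero.exp (-((d % 2 : ℕ) : ℤ)) ↔
      Valued.v (((y : LocalRing L v) - (s₁ : LocalRing L v)) w) = WithZero.exp (-((d % 2 : ℕ) : ℤ)) := by
    constructor
    · intro hz
      have heq : ((y : LocalRing L v) - (s₁ : LocalRing L v)) w = (HeisRing.heisZ (conjLocal L (IsCMField.complexConj L) v) x (y : LocalRing L v)) w +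
          -((HeisRing.heisZ (conjLocal L (IsCMField.complexConj L) v) x (y : LocalRing L v)) w - ((y : LocalRing L v) - (s₁ : LocalRing L v)) w) := by ring
      rw [heq, Valuation.map_add_eq_of_lt_left _ (by rw [Valuation.map_neg, hz]; exact hsmall), hz]
    · intro hs
      have heq : (HeisRing.heisZ (conjLocal L (IsCMField.complexConj L) v) x (y : LocalRing L v)) w = ((y : LocalRing L v) - (s₁ : LocalRing L v)) w +
          ((HeisRing.heisZ (conjLocal L (IsCMField.complexConj L) v) x (y : LocalRing L v)) w - ((y : LocalRing L v) - (s₁ : LocalRing L v)) w) := by ring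
      rw [heq, Valuation.map_add_eq_of_lt_left _ (by rw [hs]; exact hsmall), hs]
  -- the label on the clean fibre = norm class of `s ∕ t₊` (★ p859171)
  have hlab : Valued.v (((y : LocalRing L v) - (s₁ : LocalRing L v)) w) = WithZero.exp (-((d % 2 : ℕ) : ℤ)) →
      (LabelPlus (galAdicCompletionMap (L := L) (IsCMField.complexConj L) hw) ϖ d (d % 2 + 2 * d - 1)
        !![0, x w, (HeisRing.heisZ (conjLocal L (IsCMField.complexConj L) v) x (y : LocalRing L v)) w;
          0, 0, -(galAdicCompletionMap (L := L) (IsCMField.complexConj L) hw (x w)); 0, 0, (0 : w.1.adicCompletion L)] ↔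
      ∃ u : w.1.adicCompletion L, u * galAdicCompletionMap (L := L) (IsCMField.complexConj L) hw u =
        (((y : LocalRing L v) - (s₁ : LocalRing L v)) w) /
          ((ϖ - galAdicCompletionMap (L := L) (IsCMField.complexConj L) hw ϖ) * ((ϖ * galAdicCompletionMap (L := L) (IsCMField.complexConj L) hw ϖ) ^ ((d - d % 2) / 2))⁻¹)) :=
    fun hs => labelPlus_heis_iff_exists_norm_of_deep hD h2d (k := (((d % 2 + 3 * d - 1) / 2 : ℕ) : ℤ)) hx (by push_cast; omega) hzz hσs hs (div_mul_cancel₀ _ htp0)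
  have hkc1 : WithZero.exp (-(((d % 2 + 3 * d - 1) / 2 : ℕ) : ℤ)) ≤ WithZero.exp (-((d % 2 + 1 : ℕ) : ℤ)) := WithZero.exp_le_exp.2 (by push_cast; omega)
  rw [Set.mem_setOf_eq, hsw]
  constructor
  · rintro ⟨-, ⟨⟨-, hzle⟩, hnot, -⟩, hL⟩
    have hz : Valued.v ((HeisRing.heisZ (conjLocal L (IsCMField.complexConj L) v) x (y : LocalRing L v)) w) = WithZero.exp (-((d % 2 : ℕ) : ℤ)) := by
      refine le_antisymm hzle (not_lt.1 fun hlt => hnot ⟨hx.trans hkc1, ?_⟩)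
      have h3 := (valued_lt_exp_iff_le_exp_sub_one L v w _ _).1 hlt
      have e : (-((d % 2 : ℕ) : ℤ)) - 1 = -((d % 2 + 1 : ℕ) : ℤ) := by push_cast; ring
      rwa [e] at h3
    have hs := hshell_iff.1 hz
    exact ⟨hs, (hlab hs).1 hL⟩
  · rintro ⟨hs, hN⟩
    have hz := hshell_iff.2 hs
    have hle0 : WithZero.exp (-((d % 2 : ℕ) : ℤ)) ≤ 1 := by rw [← WithZero.exp_zero]; exact WithZero.exp_le_exp.2 (by omega)
    refine ⟨⟨hx.trans (WithZero.exp_le_exp.2 (by push_cast; omega)) |>.trans hle0 |> fun h => ?_, by rw [hz]; exact hle0⟩, ⟨⟨hx.trans (WithZero.exp_le_exp.2 (by push_cast; omega)), hz.le⟩, ?_, hx.trans (WithZero.exp_le_exp.2 (by push_cast; omega))⟩, (hlab hs).2 hN⟩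
    · exact hx.trans ((WithZero.exp_le_exp.2 (by push_cast; omega)).trans hle0)
    · rintro ⟨-, hz1⟩
      rw [hz] at hz1
      exact absurd (WithZero.exp_le_exp.1 hz1) (by push_cast; omega)

include hw in
/-- **UNCLEAN SECTION IS EMPTY**: if `¬ |x_w| ≤ |ϖ|^{k_c}` then no `u(x, z) ∈ N` carries `LabelPlus` at level `m*` (★ `not_labelPlus_heis_of_shallow`; `z_w + σz_w = −x_wσx_w`, ★ `heisZ_apply_add_map`).
[cite: Rogawski1990, §4.9 Prop. 4.9.1 (b) p. 55] [cite: Serre1979, Ch. III §3 Prop. 7] -/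
theorem not_labelPlus_chart_of_not_clean [Invertible (2 : LocalRing L v)] {ϖ : w.1.adicCompletion L} {d t : ℕ}
    (hD : UnitaryThreeFourFrame.IsRamifiedQuadraticDatum (galAdicCompletionMap (L := L) (IsCMField.complexConj L) hw) ϖ d t)
    {x : LocalRing L v} (hx : ¬ Valued.v (x w) ≤ WithZero.exp (-(((d % 2 + 3 * d - 1) / 2 : ℕ) : ℤ)))
    (y : HeisRing.skewPart (conjLocal L (IsCMField.complexConj L) v)) :
    ¬ LabelPlus (galAdicCompletionMap (L := L) (IsCMField.complexConj L) hw) ϖ d (d % 2 + 2 * d - 1)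
        !![0, x w, (HeisRing.heisZ (conjLocal L (IsCMField.complexConj L) v) x (y : LocalRing L v)) w;
          0, 0, -(galAdicCompletionMap (L := L) (IsCMField.complexConj L) hw (x w)); 0, 0, (0 : w.1.adicCompletion L)] := by
  obtain ⟨hσσ, hvσ, hϖ, hfix, hd, -, ht⟩ := id hD
  have hx0 : Valued.v (x w) ≠ 0 := fun h0 => hx (by rw [h0]; exact zero_le)
  obtain ⟨k', hk'⟩ : ∃ k' : ℤ, Valued.v (x w) = WithZero.exp k' := ⟨_, (WithZero.exp_log hx0).symm⟩
  have hlt : ((((d % 2 + 3 * d - 1) / 2 : ℕ) : ℤ)) > -k' := by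
    by_contra hle
    exact hx (by rw [hk']; exact WithZero.exp_le_exp.2 (by omega))
  refine not_labelPlus_heis_of_shallow hσσ hvσ hfix hϖ hd ht (heisZ_apply_add_map L v w hw x y) (k := -k') (m := d % 2 + 2 * d - 1)
    (by rw [hk', neg_neg]) (by omega)

/-! ## §3 HEAD: the labelled shell fibre volume -/

set_option maxHeartbeats 400000 in
include hw in
/-- **THE LABELLED SHELL FIBRE VOLUME.**  At a WILD ramified non-split place (`IsRamifiedQuadraticDatum σ_w ϖ d t`, `2 ≤ d`), for EVERY Haar measure `μ_N` of `N`: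
`μ_N{n ∈ K₃ : NearTransvShell ϖ (d%2) (d%2+2d−1) (n_w − 1) ∧ LabelPlus σ_w ϖ d (d%2+2d−1) (n_w − 1)} = ((1 − q⁻¹)∕2 · (q^{(d%2+3d−1)∕2 − d∕2})⁻¹) • μ_N{n ∈ K₃}`
(`q = N𝔭_v`; the support condition of ★ DEFS №3 `pieceTransvPlus` at `dOfPlace = d`, `mstarFn = mstarOfRecord d`).  F0P3-p01 (g35) FIBRE-VOLUMES row `f_{T+}`: `½(1−q⁻¹)q^{−(d−1+ℓ₀)}`.
[cite: Rogawski1990, §4.9 Prop. 4.9.1 (b) p. 55] [cite: Serre1979, Ch. V §3 Cor. 3; Ch. III §3 Prop. 7] [cite: Kottwitz1986BaseChangeUnits, §1 pp. 240–241] [cite: LanglandsShelstad1987, §3] -/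
theorem measure_setOf_mem_and_nearTransvShell_and_labelPlus_eq
    [MeasurableSpace ↥(unipotentU (conjLocal L (IsCMField.complexConj L) v) (cmLocalForm L 3 v))] [BorelSpace ↥(unipotentU (conjLocal L (IsCMField.complexConj L) v) (cmLocalForm L 3 v))]
    (μN : Measure ↥(unipotentU (conjLocal L (IsCMField.complexConj L) v) (cmLocalForm L 3 v))) [μN.IsHaarMeasure]
    (he : v.asIdeal.ramificationIdx' w.1.asIdeal ≠ 1) {ϖ : w.1.adicCompletion L} {d t : ℕ}
    (hD : UnitaryThreeFourFrame.IsRamifiedQuadraticDatum (galAdicCompletionMap (L := L) (IsCMField.complexConj L) hw) ϖ d t) (h2d : 2 ≤ d) :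
    μN {n | (n : ↥(unitaryGroupOfForm (conjLocal L (IsCMField.complexConj L) v) (cmLocalForm L 3 v))) ∈
            cmLocalIntegralLevel L 3 (Matrix.of fun i j : Fin 3 => if i.val + j.val + 1 = 3 then (1 : L) else 0) v ∧
          NearTransvShell ϖ (d % 2) (d % 2 + 2 * d - 1)
            (((n : ↥(unitaryGroupOfForm (conjLocal L (IsCMField.complexConj L) v) (cmLocalForm L 3 v))) : GL (Fin 3) (LocalRing L v)).val.map
                (Pi.evalRingHom (fun w' : PlacesOver L v => w'.1.adicCompletion L) w) - 1) ∧
          LabelPlus (galAdicCompletionMap (L := L) (IsCMField.complexConj L) hw) ϖ d (d % 2 + 2 * d - 1)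
            (((n : ↥(unitaryGroupOfForm (conjLocal L (IsCMField.complexConj L) v) (cmLocalForm L 3 v))) : GL (Fin 3) (LocalRing L v)).val.map
                (Pi.evalRingHom (fun w' : PlacesOver L v => w'.1.adicCompletion L) w) - 1)} =
      ((((1 - ((Ideal.absNorm v.asIdeal : ℝ≥0))⁻¹) / 2) * ((Ideal.absNorm v.asIdeal : ℝ≥0) ^ ((d % 2 + 3 * d - 1) / 2 - d / 2))⁻¹ : ℝ≥0)) •
        μN {n | (n : ↥(unitaryGroupOfForm (conjLocal L (IsCMField.complexConj L) v) (cmLocalForm L 3 v))) ∈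
          cmLocalIntegralLevel L 3 (Matrix.of fun i j : Fin 3 => if i.val + j.val + 1 = 3 then (1 : L) else 0) v} := by
  haveI : Algebra.IsQuadraticExtension ↥(maximalRealSubfield L) L := IsCMField.isQuadraticExtension L
  haveI : SecondCountableTopology (LocalRing L v) := secondCountableTopology_localRing (E := L) v
  letI : MeasurableSpace (LocalRing L v) := borel _
  haveI : BorelSpace (LocalRing L v) := ⟨rfl⟩
  letI : Invertible (2 : LocalRing L v) := (isUnit_two_localRing L v).invertible
  haveI := HeisRing.locallyCompactSpace_skewPart (conjLocal L (IsCMField.complexConj L) v) (continuous_conjLocal L (IsCMField.complexConj L) v)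
  haveI : SecondCountableTopology ↥(HeisRing.skewPart (conjLocal L (IsCMField.complexConj L) v)) := TopologicalSpace.Subtype.secondCountableTopology _
  obtain ⟨μX, hμX⟩ : ∃ μ : Measure (LocalRing L v), μ = Measure.addHaar := ⟨_, rfl⟩
  obtain ⟨μY, hμY⟩ : ∃ μ : Measure ↥(HeisRing.skewPart (conjLocal L (IsCMField.complexConj L) v)), μ = Measure.addHaar := ⟨_, rfl⟩
  haveI : μX.IsAddHaarMeasure := by rw [hμX]; infer_instance
  haveI : μX.Regular := by rw [hμX]; infer_instance
  haveI : μY.IsAddHaarMeasure := by rw [hμY]; infer_instance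
  haveI : μY.Regular := by rw [hμY]; infer_instance
  have hϖ : Valued.v ϖ = WithZero.exp (-1 : ℤ) := hD.2.2.1
  have hσw : ∀ r : LocalRing L v, conjLocal L (IsCMField.complexConj L) v r w = galAdicCompletionMap (L := L) (IsCMField.complexConj L) hw (r w) :=
    fun r => conjLocal_apply_eq_of_smul_eq (IsCMField.complexConj L) (IsCMField.complexConj_ne_one L) v w hw r
  obtain ⟨κ, hκ⟩ := exists_measure_eq_mul_prod_preimage_heisHomeomorph L v μN μX μY
  -- the chart preimage of the labelled shell set
  have hpre : (HeisRing.heisHomeomorph (conjLocal L (IsCMField.complexConj L) v) (conjLocal_conjLocal_cm L v) (continuous_conjLocal L (IsCMField.complexConj L) v)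
        (cmLocalForm_eq_over L 3 v)) ⁻¹'
        {n | (n : ↥(unitaryGroupOfForm (conjLocal L (IsCMField.complexConj L) v) (cmLocalForm L 3 v))) ∈
            cmLocalIntegralLevel L 3 (Matrix.of fun i j : Fin 3 => if i.val + j.val + 1 = 3 then (1 : L) else 0) v ∧
          NearTransvShell ϖ (d % 2) (d % 2 + 2 * d - 1)
            (((n : ↥(unitaryGroupOfForm (conjLocal L (IsCMField.complexConj L) v) (cmLocalForm L 3 v))) : GL (Fin 3) (LocalRing L v)).val.map
                (Pi.evalRingHom (fun w' : PlacesOver L v => w'.1.adicCompletion L) w) - 1) ∧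
          LabelPlus (galAdicCompletionMap (L := L) (IsCMField.complexConj L) hw) ϖ d (d % 2 + 2 * d - 1)
            (((n : ↥(unitaryGroupOfForm (conjLocal L (IsCMField.complexConj L) v) (cmLocalForm L 3 v))) : GL (Fin 3) (LocalRing L v)).val.map
                (Pi.evalRingHom (fun w' : PlacesOver L v => w'.1.adicCompletion L) w) - 1)} =
      {p : LocalRing L v × HeisRing.skewPart (conjLocal L (IsCMField.complexConj L) v) |
        ((Valued.v (p.1 w) ≤ 1 ∧ Valued.v ((HeisRing.heisZ (conjLocal L (IsCMField.complexConj L) v) p.1 (p.2 : LocalRing L v)) w) ≤ 1) ∧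
          ((Valued.v (p.1 w) ≤ WithZero.exp (-((d % 2 : ℕ) : ℤ)) ∧ Valued.v ((HeisRing.heisZ (conjLocal L (IsCMField.complexConj L) v) p.1 (p.2 : LocalRing L v)) w) ≤ WithZero.exp (-((d % 2 : ℕ) : ℤ))) ∧
            ¬ (Valued.v (p.1 w) ≤ WithZero.exp (-((d % 2 + 1 : ℕ) : ℤ)) ∧
                Valued.v ((HeisRing.heisZ (conjLocal L (IsCMField.complexConj L) v) p.1 (p.2 : LocalRing L v)) w) ≤ WithZero.exp (-((d % 2 + 1 : ℕ) : ℤ))) ∧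
            Valued.v (p.1 w) ≤ WithZero.exp (-(((d % 2 + 2 * d - 1 + 1) / 2 : ℕ) : ℤ))) ∧
          LabelPlus (galAdicCompletionMap (L := L) (IsCMField.complexConj L) hw) ϖ d (d % 2 + 2 * d - 1)
            !![0, p.1 w, (HeisRing.heisZ (conjLocal L (IsCMField.complexConj L) v) p.1 (p.2 : LocalRing L v)) w;
              0, 0, -(galAdicCompletionMap (L := L) (IsCMField.complexConj L) hw (p.1 w)); 0, 0, (0 : w.1.adicCompletion L)])} := by
    ext ⟨x, y⟩
    simp only [Set.mem_preimage, Set.mem_setOf_eq, HeisRing.heisHomeomorph_apply, NearTransvShell, InLevel]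
    rw [heisElt_mem_cmLocalIntegralLevel_iff_heisZ L v w hw x y, forall_valued_map_heisElt_sub_one_le_iff L v w hw hϖ (d % 2) x y,
      forall_valued_map_heisElt_sub_one_le_iff L v w hw hϖ (d % 2 + 1) x y, forall_valued_map_heisElt_sub_one_mul_self_le_iff L v w hw hϖ (d % 2 + 2 * d - 1) x y,
      map_heisElt_sub_one_eq L v w x y, hσw x]
  -- measurability: the label locus is open (★ FILE 4b), the other conditions are closed ball conditions
  have hcz : Continuous fun p : LocalRing L v × HeisRing.skewPart (conjLocal L (IsCMField.complexConj L) v) =>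
      (HeisRing.heisZ (conjLocal L (IsCMField.complexConj L) v) p.1 (p.2 : LocalRing L v)) w := by
    refine (continuous_apply w).comp ?_
    show Continuous fun p : LocalRing L v × HeisRing.skewPart (conjLocal L (IsCMField.complexConj L) v) =>
      (p.2 : LocalRing L v) - ⅟(2 : LocalRing L v) * (p.1 * conjLocal L (IsCMField.complexConj L) v p.1)
    exact (continuous_subtype_val.comp continuous_snd).sub
      (continuous_const.mul (continuous_fst.mul ((continuous_conjLocal L (IsCMField.complexConj L) v).comp continuous_fst)))
  have hmx : ∀ k : ℕ, MeasurableSet {p : LocalRing L v × HeisRing.skewPart (conjLocal L (IsCMField.complexConj L) v) | Valued.v (p.1 w) ≤ WithZero.exp (-(k : ℤ))} :=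
    fun k => ((isClosed_setOf_valued_apply_le_exp_neg L v w hϖ k).preimage continuous_fst).measurableSet
  have hmz : ∀ k : ℕ, MeasurableSet {p : LocalRing L v × HeisRing.skewPart (conjLocal L (IsCMField.complexConj L) v) |
      Valued.v ((HeisRing.heisZ (conjLocal L (IsCMField.complexConj L) v) p.1 (p.2 : LocalRing L v)) w) ≤ WithZero.exp (-(k : ℤ))} :=
    fun k => ((isClopen_setOf_valued_le_exp_neg L v w hϖ k).1.preimage hcz).measurableSet
  have h10 : WithZero.exp (-((0 : ℕ) : ℤ)) = (1 : ℤᵐ⁰) := by rw [Nat.cast_zero, neg_zero, WithZero.exp_zero]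
  have hT : MeasurableSet {p : LocalRing L v × HeisRing.skewPart (conjLocal L (IsCMField.complexConj L) v) |
        ((Valued.v (p.1 w) ≤ 1 ∧ Valued.v ((HeisRing.heisZ (conjLocal L (IsCMField.complexConj L) v) p.1 (p.2 : LocalRing L v)) w) ≤ 1) ∧
          ((Valued.v (p.1 w) ≤ WithZero.exp (-((d % 2 : ℕ) : ℤ)) ∧ Valued.v ((HeisRing.heisZ (conjLocal L (IsCMField.complexConj L) v) p.1 (p.2 : LocalRing L v)) w) ≤ WithZero.exp (-((d % 2 : ℕ) : ℤ))) ∧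
            ¬ (Valued.v (p.1 w) ≤ WithZero.exp (-((d % 2 + 1 : ℕ) : ℤ)) ∧
                Valued.v ((HeisRing.heisZ (conjLocal L (IsCMField.complexConj L) v) p.1 (p.2 : LocalRing L v)) w) ≤ WithZero.exp (-((d % 2 + 1 : ℕ) : ℤ))) ∧
            Valued.v (p.1 w) ≤ WithZero.exp (-(((d % 2 + 2 * d - 1 + 1) / 2 : ℕ) : ℤ))) ∧
          LabelPlus (galAdicCompletionMap (L := L) (IsCMField.complexConj L) hw) ϖ d (d % 2 + 2 * d - 1)
            !![0, p.1 w, (HeisRing.heisZ (conjLocal L (IsCMField.complexConj L) v) p.1 (p.2 : LocalRing L v)) w;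
              0, 0, -(galAdicCompletionMap (L := L) (IsCMField.complexConj L) hw (p.1 w)); 0, 0, (0 : w.1.adicCompletion L)])} := by
    have e : {p : LocalRing L v × HeisRing.skewPart (conjLocal L (IsCMField.complexConj L) v) |
        ((Valued.v (p.1 w) ≤ 1 ∧ Valued.v ((HeisRing.heisZ (conjLocal L (IsCMField.complexConj L) v) p.1 (p.2 : LocalRing L v)) w) ≤ 1) ∧
          ((Valued.v (p.1 w) ≤ WithZero.exp (-((d % 2 : ℕ) : ℤ)) ∧ Valued.v ((HeisRing.heisZ (conjLocal L (IsCMField.complexConj L) v) p.1 (p.2 : LocalRing L v)) w) ≤ WithZero.exp (-((d % 2 : ℕ) : ℤ))) ∧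
            ¬ (Valued.v (p.1 w) ≤ WithZero.exp (-((d % 2 + 1 : ℕ) : ℤ)) ∧
                Valued.v ((HeisRing.heisZ (conjLocal L (IsCMField.complexConj L) v) p.1 (p.2 : LocalRing L v)) w) ≤ WithZero.exp (-((d % 2 + 1 : ℕ) : ℤ))) ∧
            Valued.v (p.1 w) ≤ WithZero.exp (-(((d % 2 + 2 * d - 1 + 1) / 2 : ℕ) : ℤ))) ∧
          LabelPlus (galAdicCompletionMap (L := L) (IsCMField.complexConj L) hw) ϖ d (d % 2 + 2 * d - 1)
            !![0, p.1 w, (HeisRing.heisZ (conjLocal L (IsCMField.complexConj L) v) p.1 (p.2 : LocalRing L v)) w;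
              0, 0, -(galAdicCompletionMap (L := L) (IsCMField.complexConj L) hw (p.1 w)); 0, 0, (0 : w.1.adicCompletion L)])} =
      (({p : LocalRing L v × HeisRing.skewPart (conjLocal L (IsCMField.complexConj L) v) | Valued.v (p.1 w) ≤ WithZero.exp (-((0 : ℕ) : ℤ))} ∩
          {p | Valued.v ((HeisRing.heisZ (conjLocal L (IsCMField.complexConj L) v) p.1 (p.2 : LocalRing L v)) w) ≤ WithZero.exp (-((0 : ℕ) : ℤ))}) ∩
        (({p : LocalRing L v × HeisRing.skewPart (conjLocal L (IsCMField.complexConj L) v) | Valued.v (p.1 w) ≤ WithZero.exp (-((d % 2 : ℕ) : ℤ))} ∩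
            {p | Valued.v ((HeisRing.heisZ (conjLocal L (IsCMField.complexConj L) v) p.1 (p.2 : LocalRing L v)) w) ≤ WithZero.exp (-((d % 2 : ℕ) : ℤ))}) ∩
          ({p : LocalRing L v × HeisRing.skewPart (conjLocal L (IsCMField.complexConj L) v) | Valued.v (p.1 w) ≤ WithZero.exp (-((d % 2 + 1 : ℕ) : ℤ))} ∩
            {p | Valued.v ((HeisRing.heisZ (conjLocal L (IsCMField.complexConj L) v) p.1 (p.2 : LocalRing L v)) w) ≤ WithZero.exp (-((d % 2 + 1 : ℕ) : ℤ))})ᶜ ∩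
          {p : LocalRing L v × HeisRing.skewPart (conjLocal L (IsCMField.complexConj L) v) | Valued.v (p.1 w) ≤ WithZero.exp (-(((d % 2 + 2 * d - 1 + 1) / 2 : ℕ) : ℤ))}) ∩
        {p : LocalRing L v × HeisRing.skewPart (conjLocal L (IsCMField.complexConj L) v) |
          LabelPlus (galAdicCompletionMap (L := L) (IsCMField.complexConj L) hw) ϖ d (d % 2 + 2 * d - 1)
            !![0, p.1 w, (HeisRing.heisZ (conjLocal L (IsCMField.complexConj L) v) p.1 (p.2 : LocalRing L v)) w;
              0, 0, -(galAdicCompletionMap (L := L) (IsCMField.complexConj L) hw (p.1 w)); 0, 0, (0 : w.1.adicCompletion L)]}) := by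
      ext p
      simp only [Set.mem_setOf_eq, Set.mem_inter_iff, Set.mem_compl_iff, h10]
      tauto
    rw [e]
    exact ((((hmx 0).inter (hmz 0)).inter ((((hmx _).inter (hmz _)).inter ((hmx _).inter (hmz _)).compl).inter (hmx _))).inter
      (isOpen_setOf_labelPlus_chart L v w hw hϖ d (d % 2 + 2 * d - 1)).measurableSet)
  -- Tonelli with translate sections: clean `x` ↦ translate of `A₊`, unclean ↦ `∅`
  have hA : MeasurableSet {x : LocalRing L v | Valued.v (x w) ≤ WithZero.exp (-(((d % 2 + 3 * d - 1) / 2 : ℕ) : ℤ))} :=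
    (isClosed_setOf_valued_apply_le_exp_neg L v w hϖ _).measurableSet
  have hprod := prod_apply_eq_mul_of_sections_vadd L v μX μY hT hA
    (B := {s : HeisRing.skewPart (conjLocal L (IsCMField.complexConj L) v) |
        Valued.v ((s : LocalRing L v) w) = WithZero.exp (-((d % 2 : ℕ) : ℤ)) ∧
          ∃ u : w.1.adicCompletion L, u * galAdicCompletionMap (L := L) (IsCMField.complexConj L) hw u =
            ((s : LocalRing L v) w) /
              ((ϖ - galAdicCompletionMap (L := L) (IsCMField.complexConj L) hw ϖ) * ((ϖ * galAdicCompletionMap (L := L) (IsCMField.complexConj L) hw ϖ) ^ ((d - d % 2) / 2))⁻¹)})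
    (fun x hx => by
      obtain ⟨s₁, hs₁⟩ := exists_skew_forall_valued_heisZ_sub_le L v w hw hD hx
      refine ⟨s₁, Set.ext fun y => ?_⟩
      rw [Set.mem_vadd_set_iff_neg_vadd_mem, vadd_eq_add, Set.mem_preimage, Set.mem_setOf_eq]
      exact mem_section_labelled_iff_of_clean L v w hw hD h2d hx hs₁ y)
    (fun x hx => Set.eq_empty_of_forall_notMem fun y hy => not_labelPlus_chart_of_not_clean L v w hw hD hx y hy.2.2)
  -- assemble
  rw [hκ, hκ, hpre, hprod, preimage_heisHomeomorph_setOf_mem_eq L v w hw, prod_setOf_valued_le_and_valued_heisZ_le L v w hw hD _ _ μX μY,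
    measure_setOf_valued_apply_le_exp_neg_of_ramified L v w hw μX he, measure_setOf_valued_apply_le_exp_neg_of_ramified L v w hw μX he,
    measure_skewShell_isNorm_eq L v w hw μY he hD, h10, show (max 0 ((0 + d) / 2) : ℕ) = d / 2 by rw [Nat.zero_add, Nat.zero_max]]
  exact ENNReal.mul_inv_pow_smul_mul_smul _ κ _ _ _ (by omega)

end Summit.HodgeConjecture.HodgeConjecture.Cruxes.H413.F0P3cDyRamTransvPlusUnipotentVolume

end
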